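import Summits.BirchSwinnertonDyer.BirchSwinnertonDyer.Theorems.UniversalToricDescentThinCombDescentSubst
import HarnessLib

/-!
# Two-variable substitutions of `Λ₂(R) = R⟦T₂⟧⟦T₁⟧`, part II: the shear automorphisms
# `α_e : T₁ ↦ T₂ − ((1+T₁)^e − 1), T₂ ↦ T₁` and the specialisation `φ_e : T₁ ↦ T, T₂ ↦ (1+T)^e − 1`
# (line `thin_comb` v3 on the WALL `AdditiveSplitIMCInclusionAtThree`, stmt-BirchSwinnertonDyer-20395; helper for
# `stub_descent`, `--supports`; cell `pub/bsd-wall`, lead `cruxlead-20395` g3)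

WHY. `stub_descent` (v3) specialises `ch_{Λ₂}(X₂) = (g)` along the anticyclotomic line
`𝔞_k = (T₂ − ((1+T₁)^{3^k} − 1))` of a 𝔭-adapted frame; the tree's machinery specialises along `(T₁)`
(`PowerSeries.constantCoeff`). Sequel of `…DescentSubst.lean` (outer substitutions, swap, uniqueness of continuous
ring homomorphisms; same LOCAL discrete-topology device, nothing topological is exported):

* the shear **`alpha e`** (`T₁ ↦ T₂ − ((1+T₁)^e − 1)`, `T₂ ↦ T₁`) with inverse `beta e`
  (`= swap ∘ (T₁ ↦ T₂ + u_e(T₁), T₂ ↦ T₁) ∘ swap`, the swap being the tree's `IntSeries.transposeRingEquiv`): `alpha_comp_beta`, `beta_comp_alpha`, the ring automorphism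
  **`alphaEquiv e`** of `R⟦T₂⟧⟦T₁⟧`;
* the specialisation **`spec e : R⟦T₂⟧⟦T₁⟧ →+* R⟦T⟧`** (`T₁ ↦ T`, `T₂ ↦ (1+T)^e − 1`): `spec_comp_toOuter`
  (`φ_e(L(T₁)) = L`), `spec_ker_gen` (`φ_e (T₂ − ((1+T₁)^e − 1)) = 0`), **`spec_comp_alpha : φ_e ∘ α_e = constantCoeff`**
  (hence `φ_e = constantCoeff ∘ α_e⁻¹`, `spec_eq_constantCoeff_symm`) and naturality in `R` (`map_comp_spec`, for
  `ℤ₃ → R₀`).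
So the α_e-twist of a `Λ₂`-module `X` has `X^{α}/T₁X^{α} = X/𝔞 X` and `(ch X^{α}) (T₁ ↦ 0) = φ_e(ch X)`.

Pure commutative algebra (Bourbaki, Algèbre IV §4 no. 3; Washington §7.1, §13.2); nothing about elliptic curves;
BSD is not proved by any of this.
-/

set_option linter.dupNamespace false
set_option autoImplicit false

noncomputable section

namespace Summit.BirchSwinnertonDyer.BirchSwinnertonDyer.Theorems.UniversalToricDescentThinComb.TwoVarSubst

open PowerSeries Literature.NumberTheory.EllipticCurves

variable {R : Type*} [CommRing R]

/-- The tree's swap `T₁ ↔ T₂` (`IntSeries.transposeRingEquiv`, de Shalit II.4.17 (54)) as a ring homomorphism. -/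
abbrev swapHom : PowerSeries (PowerSeries R) →+* PowerSeries (PowerSeries R) :=
  (IntSeries.transposeRingEquiv R).toRingHom

/-- `swap T₁ = T₂`. [cite: deShalit1987, II.4.17 (54) (p. 78)] -/
theorem swapHom_X : swapHom (R := R) X = C X := IntSeries.transpose_X

/-- `swap T₂ = T₁`. [cite: deShalit1987, II.4.17 (54) (p. 78)] -/
theorem swapHom_C_X : swapHom (R := R) (C X) = X := transpose_C_X

/-- `swap` fixes constants. [cite: deShalit1987, II.4.17 (54) (p. 78)] -/
theorem swapHom_C_C (c : R) : swapHom (R := R) (C (C c)) = C (C c) := transpose_C_C c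

section Topology

attribute [local instance] instUniformSpaceDiscrete instDiscreteUniformityDiscrete

open PowerSeries.WithPiTopology MvPowerSeries.WithPiTopology

/-- The swap is continuous (product topology). [folklore] -/
theorem continuous_swapHom : Continuous (swapHom (R := R)) := continuous_transpose

/-! ### The shear automorphisms `α_e : T₁ ↦ T₂ − ((1+T₁)^e − 1), T₂ ↦ T₁` -/

/-- `u_e(T₁) = (1 + T₁)^e − 1` (outer variable). -/
def uOuter (e : ℕ) : PowerSeries (PowerSeries R) := (1 + X) ^ e - 1

/-- Unfolding `uOuter`. -/
theorem uOuter_def (e : ℕ) : uOuter (R := R) e = (1 + X) ^ e - 1 := rfl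

/-- `u_e` has zero total constant term. [folklore] -/
theorem constantCoeff₂_uOuter (e : ℕ) :
    PowerSeries.constantCoeff (PowerSeries.constantCoeff (uOuter (R := R) e)) = 0 := by
  simp [uOuter_def]

/-- **`α_e`**: `T₁ ↦ T₂ − ((1+T₁)^e − 1)`, `T₂ ↦ T₁`. [folklore] -/
def alpha (e : ℕ) : PowerSeries (PowerSeries R) →+* PowerSeries (PowerSeries R) :=
  substOuter (C X - uOuter e) (by
    rw [map_sub, map_sub, PowerSeries.constantCoeff_C, PowerSeries.constantCoeff_X, zero_sub,
      constantCoeff₂_uOuter, neg_zero])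

/-- `T₁ ↦ T₂ + ((1+T₁)^e − 1)`, `T₂ ↦ T₁` (the conjugate of `β_e` by the swap). [folklore] -/
def betaCore (e : ℕ) : PowerSeries (PowerSeries R) →+* PowerSeries (PowerSeries R) :=
  substOuter (C X + uOuter e) (by
    rw [map_add, map_add, PowerSeries.constantCoeff_C, PowerSeries.constantCoeff_X, zero_add,
      constantCoeff₂_uOuter])

/-- **`β_e = α_e⁻¹`**: `T₁ ↦ T₂`, `T₂ ↦ T₁ + ((1+T₂)^e − 1)`, built as `swap ∘ (T₁ ↦ T₂ + u_e(T₁), T₂ ↦ T₁) ∘ swap`.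
[folklore] -/
def beta (e : ℕ) : PowerSeries (PowerSeries R) →+* PowerSeries (PowerSeries R) :=
  swapHom.comp ((betaCore e).comp swapHom)

variable (e : ℕ)

/-- `α_e` is continuous (product topology). [folklore] -/
theorem continuous_alpha : Continuous (alpha (R := R) e) := continuous_substOuter _ _

/-- The conjugated shear is continuous. [folklore] -/
theorem continuous_betaCore : Continuous (betaCore (R := R) e) := continuous_substOuter _ _

/-- The conjugated shear on `T₁`. [folklore] -/
theorem betaCore_X : betaCore (R := R) e X = C X + uOuter e := substOuter_X _ _

/-- The conjugated shear on `T₂`. [folklore] -/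
theorem betaCore_C_X : betaCore (R := R) e (C X) = X := substOuter_C_X _ _

/-- The conjugated shear fixes constants. [folklore] -/
theorem betaCore_C_C (c : R) : betaCore (R := R) e (C (C c)) = C (C c) := substOuter_C_C _ _ c

/-- `β_e` is continuous. [folklore] -/
theorem continuous_beta : Continuous (beta (R := R) e) :=
  continuous_ringHom_comp continuous_swapHom (continuous_ringHom_comp (continuous_betaCore e) continuous_swapHom)

/-- `α_e T₁ = T₂ − ((1+T₁)^e − 1)`. [folklore] -/
theorem alpha_X : alpha (R := R) e X = C X - uOuter e := substOuter_X _ _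

/-- `α_e T₂ = T₁`. [folklore] -/
theorem alpha_C_X : alpha (R := R) e (C X) = X := substOuter_C_X _ _

/-- `α_e` fixes constants. [folklore] -/
theorem alpha_C_C (c : R) : alpha (R := R) e (C (C c)) = C (C c) := substOuter_C_C _ _ c

/-- A ring homomorphism maps `u_e(T₁)` to `u_e` of the image of `T₁`. [folklore] -/
theorem map_uOuter_eq {T : Type*} [CommRing T] (ε : PowerSeries (PowerSeries R) →+* T) :
    ε (uOuter e) = (1 + ε X) ^ e - 1 := by
  simp [uOuter_def]

/-- A ring homomorphism maps `u_e(T₂)` to `u_e` of the image of `T₂`. [folklore] -/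
theorem map_uInner_eq {T : Type*} [CommRing T] (ε : PowerSeries (PowerSeries R) →+* T) :
    ε ((1 + C X) ^ e - 1) = (1 + ε (C X)) ^ e - 1 := by
  simp

/-- `β_e T₁ = T₂`. [folklore] -/
theorem beta_X : beta (R := R) e X = C X := by
  rw [beta, RingHom.comp_apply, RingHom.comp_apply, swapHom_X, betaCore_C_X, swapHom_X]

/-- `β_e T₂ = T₁ + ((1+T₂)^e − 1)`. [folklore] -/
theorem beta_C_X : beta (R := R) e (C X) = X + ((1 + C X) ^ e - 1) := by
  rw [beta, RingHom.comp_apply, RingHom.comp_apply, swapHom_C_X, betaCore_X, map_add, swapHom_C_X,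
    map_uOuter_eq, swapHom_X]

/-- `β_e` fixes constants. [folklore] -/
theorem beta_C_C (c : R) : beta (R := R) e (C (C c)) = C (C c) := by
  rw [beta, RingHom.comp_apply, RingHom.comp_apply, swapHom_C_C, betaCore_C_C, swapHom_C_C]

/-- `α_e ∘ β_e = id`. [folklore] -/
theorem alpha_comp_beta : (alpha (R := R) e).comp (beta e) = RingHom.id _ := by
  refine ringHom_ext₂_of_continuous (continuous_ringHom_comp (continuous_alpha e) (continuous_beta e))
    continuous_ringHom_id ?_ ?_ (fun c => ?_)
  · rw [RingHom.comp_apply, beta_X, alpha_C_X, RingHom.id_apply]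
  · rw [RingHom.comp_apply, beta_C_X, map_add, alpha_X, map_uInner_eq, alpha_C_X, ← uOuter_def,
      RingHom.id_apply, sub_add_cancel]
  · rw [RingHom.comp_apply, beta_C_C, alpha_C_C, RingHom.id_apply]

/-- `β_e ∘ α_e = id`. [folklore] -/
theorem beta_comp_alpha : (beta (R := R) e).comp (alpha e) = RingHom.id _ := by
  refine ringHom_ext₂_of_continuous (continuous_ringHom_comp (continuous_beta e) (continuous_alpha e))
    continuous_ringHom_id ?_ ?_ (fun c => ?_)
  · rw [RingHom.comp_apply, alpha_X, map_sub, beta_C_X, map_uOuter_eq, beta_X, RingHom.id_apply,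
      add_sub_cancel_right]
  · rw [RingHom.comp_apply, alpha_C_X, beta_X, RingHom.id_apply]
  · rw [RingHom.comp_apply, alpha_C_C, beta_C_C, RingHom.id_apply]

/-! ### The specialisation `φ_e : T₁ ↦ T, T₂ ↦ (1+T)^e − 1` onto `R⟦T⟧` -/

/-- `(1+T)^e − 1` is topologically nilpotent in `R⟦T⟧`. [folklore] -/
theorem hasEval_u : PowerSeries.HasEval ((1 + X) ^ e - 1 : PowerSeries R) :=
  PowerSeries.WithPiTopology.isTopologicallyNilpotent_of_constantCoeff_zero (by simp)

/-- `T₁` is topologically nilpotent in `R⟦T₂⟧⟦T₁⟧`. [folklore] -/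
theorem hasEval_X₂ : PowerSeries.HasEval (X : PowerSeries (PowerSeries R)) :=
  PowerSeries.WithPiTopology.isTopologicallyNilpotent_of_constantCoeff_zero (PowerSeries.constantCoeff_X)

/-- `C : R → R⟦T⟧` is continuous. [folklore] -/
theorem continuous_C₁ : Continuous (C : R →+* PowerSeries R) := PowerSeries.WithPiTopology.continuous_C

/-- The one-variable substitution `σ_e : T ↦ (1+T)^e − 1` of `R⟦T⟧`. [folklore] -/
def sigma (e : ℕ) : PowerSeries R →+* PowerSeries R :=
  PowerSeries.eval₂Hom (continuous_C₁ (R := R)) (hasEval_u (R := R) e)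

/-- `σ_e` is continuous. [folklore] -/
theorem continuous_sigma : Continuous (sigma (R := R) e) := by
  rw [sigma, PowerSeries.coe_eval₂Hom]
  exact PowerSeries.continuous_eval₂ continuous_C₁ (hasEval_u e)

/-- `σ_e T = (1+T)^e − 1`. [folklore] -/
theorem sigma_X : sigma (R := R) e X = (1 + X) ^ e - 1 := by
  rw [sigma, PowerSeries.coe_eval₂Hom, PowerSeries.eval₂_X]

/-- `σ_e` fixes constants. [folklore] -/
theorem sigma_C (c : R) : sigma (R := R) e (C c) = C c := by
  rw [sigma, PowerSeries.coe_eval₂Hom, PowerSeries.eval₂_C]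

/-- **`φ_e : R⟦T₂⟧⟦T₁⟧ → R⟦T⟧`, `T₁ ↦ T`, `T₂ ↦ (1+T)^e − 1`** (kernel `((1 + T₂) − (1 + T₁)^e)`). [folklore] -/
def spec (e : ℕ) : PowerSeries (PowerSeries R) →+* PowerSeries R :=
  PowerSeries.eval₂Hom (a := (X : PowerSeries R)) (continuous_sigma (R := R) e)
    (PowerSeries.WithPiTopology.isTopologicallyNilpotent_of_constantCoeff_zero (PowerSeries.constantCoeff_X))

/-- `φ_e` is continuous. [folklore] -/
theorem continuous_spec : Continuous (spec (R := R) e) := by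
  rw [spec, PowerSeries.coe_eval₂Hom]
  exact PowerSeries.continuous_eval₂ (continuous_sigma e)
    (PowerSeries.WithPiTopology.isTopologicallyNilpotent_of_constantCoeff_zero (PowerSeries.constantCoeff_X))

/-- `φ_e T₁ = T`. [folklore] -/
theorem spec_X : spec (R := R) e X = X := by
  rw [spec, PowerSeries.coe_eval₂Hom, PowerSeries.eval₂_X]

/-- `φ_e (f(T₂)) = f((1+T)^e − 1)`. [folklore] -/
theorem spec_C (f : PowerSeries R) : spec (R := R) e (C f) = sigma e f := by
  rw [spec, PowerSeries.coe_eval₂Hom, PowerSeries.eval₂_C]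

/-- `φ_e T₂ = (1+T)^e − 1`. [folklore] -/
theorem spec_C_X : spec (R := R) e (C X) = (1 + X) ^ e - 1 := by
  rw [spec_C, sigma_X]

/-- `φ_e` fixes constants. [folklore] -/
theorem spec_C_C (c : R) : spec (R := R) e (C (C c)) = C c := by
  rw [spec_C, sigma_C]

/-- `φ_e` kills `T₂ − ((1+T₁)^e − 1)`. [folklore] -/
theorem spec_C_X_sub_uOuter : spec (R := R) e (C X - uOuter e) = 0 := by
  rw [map_sub, spec_C_X, map_uOuter_eq, spec_X, sub_self]

/-- `φ_e (L(T₁)) = L`: the outer reading is a section of `φ_e`. [folklore] -/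
theorem spec_comp_toOuter : (spec (R := R) e).comp toOuter = RingHom.id _ :=
  ringHom_ext_of_continuous (continuous_ringHom_comp (continuous_spec e) continuous_toOuter) continuous_ringHom_id
    (by rw [RingHom.comp_apply, toOuter_X, spec_X, RingHom.id_apply])
    (fun c => by rw [RingHom.comp_apply, toOuter_C, spec_C_C, RingHom.id_apply])

/-- **`φ_e ∘ α_e = (T₁ ↦ 0)`**: after the shear `α_e`, the specialisation `φ_e` is the constant-term map
`PowerSeries.constantCoeff : R⟦T₂⟧⟦T₁⟧ → R⟦T₂⟧`. [folklore] -/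
theorem spec_comp_alpha : (spec (R := R) e).comp (alpha e) = PowerSeries.constantCoeff := by
  refine ringHom_ext₂_of_continuous (continuous_ringHom_comp (continuous_spec e) (continuous_alpha e))
    (PowerSeries.WithPiTopology.continuous_constantCoeff (PowerSeries R)) ?_ ?_ (fun c => ?_)
  · rw [RingHom.comp_apply, alpha_X, spec_C_X_sub_uOuter, PowerSeries.constantCoeff_X]
  · rw [RingHom.comp_apply, alpha_C_X, spec_X, PowerSeries.constantCoeff_C]
  · rw [RingHom.comp_apply, alpha_C_C, spec_C_C, PowerSeries.constantCoeff_C]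

/-- **`φ_e ∘ β_e⁻¹`-form: `φ_e = constantCoeff ∘ β_e`.** [folklore] -/
theorem constantCoeff_comp_beta : (PowerSeries.constantCoeff (R := PowerSeries R)).comp (beta e) = spec e := by
  rw [← spec_comp_alpha, RingHom.comp_assoc, alpha_comp_beta, RingHom.comp_id]

/-! ### Naturality in the coefficient ring -/

variable {R' : Type*} [CommRing R']

/-- LOCAL: the discrete uniformity on the second coefficient ring `R'`. -/
local instance instUniformSpaceDiscrete' : UniformSpace R' := ⊥

/-- LOCAL: `⊥` is the discrete uniformity (second ring). -/
local instance instDiscreteUniformityDiscrete' : DiscreteUniformity R' := by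
  change @DiscreteUniformity R' ⊥
  infer_instance

/-- **`φ_e` commutes with extension of scalars**: for `τ : R → R'`,
`τ ∘ φ_e = φ_e ∘ τ` (coefficientwise `τ` on both sides). [folklore] -/
theorem map_comp_spec (τ : R →+* R') :
    (PowerSeries.map τ).comp (spec (R := R) e) =
      (spec (R := R') e).comp (PowerSeries.map (PowerSeries.map τ)) := by
  have hτ : Continuous τ := continuous_of_discreteTopology
  refine ringHom_ext₂_of_continuous
    (continuous_ringHom_comp (continuous_map τ hτ) (continuous_spec e))
    (continuous_ringHom_comp (continuous_spec e) (continuous_map _ (continuous_map τ hτ))) ?_ ?_ (fun c => ?_)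
  · rw [RingHom.comp_apply, RingHom.comp_apply, spec_X, PowerSeries.map_X, PowerSeries.map_X, spec_X]
  · rw [RingHom.comp_apply, RingHom.comp_apply, spec_C_X, PowerSeries.map_C, PowerSeries.map_X, spec_C_X,
      map_sub, map_pow, map_add, map_one, PowerSeries.map_X]
  · rw [RingHom.comp_apply, RingHom.comp_apply, spec_C_C, PowerSeries.map_C, PowerSeries.map_C,
      PowerSeries.map_C, spec_C_C]

/-- Pointwise form of `map_comp_spec`. [folklore] -/
theorem map_spec (τ : R →+* R') (F : PowerSeries (PowerSeries R)) :
    PowerSeries.map τ (spec e F) = spec e (PowerSeries.map (PowerSeries.map τ) F) := by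
  simpa using congrArg (fun g : PowerSeries (PowerSeries R) →+* PowerSeries R' => g F) (map_comp_spec e τ)

end Topology

/-! ### Algebraic packaging: the shear as a `RingEquiv` -/

/-- **The shear `α_e` as a ring automorphism** of `R⟦T₂⟧⟦T₁⟧` (inverse `β_e`). [folklore] -/
def alphaEquiv (e : ℕ) : PowerSeries (PowerSeries R) ≃+* PowerSeries (PowerSeries R) :=
  RingEquiv.ofRingHom (alpha e) (beta e) (alpha_comp_beta e) (beta_comp_alpha e)

/-- `alphaEquiv e` acts as `alpha e`. -/
@[simp] theorem alphaEquiv_apply (e : ℕ) (F : PowerSeries (PowerSeries R)) :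
    alphaEquiv e F = alpha e F := rfl

/-- `(alphaEquiv e).symm` acts as `beta e`. -/
@[simp] theorem alphaEquiv_symm_apply (e : ℕ) (F : PowerSeries (PowerSeries R)) :
    (alphaEquiv e).symm F = beta e F := rfl

/-- `φ_e = constantCoeff ∘ α_e⁻¹` pointwise. [folklore] -/
theorem spec_eq_constantCoeff_symm (e : ℕ) (F : PowerSeries (PowerSeries R)) :
    spec e F = PowerSeries.constantCoeff ((alphaEquiv e).symm F) := by
  rw [alphaEquiv_symm_apply, ← constantCoeff_comp_beta, RingHom.comp_apply]

/-- `φ_e ∘ α_e = constantCoeff` pointwise. [folklore] -/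
theorem spec_alpha (e : ℕ) (F : PowerSeries (PowerSeries R)) :
    spec e (alpha e F) = PowerSeries.constantCoeff F := by
  rw [← RingHom.comp_apply, spec_comp_alpha]

/-- `φ_e (L(T₁)) = L` pointwise. [folklore] -/
theorem spec_toOuter (e : ℕ) (L : PowerSeries R) : spec e (toOuter L) = L := by
  rw [← RingHom.comp_apply, spec_comp_toOuter, RingHom.id_apply]

/-- `α_e T₁` generates the kernel direction of `φ_e`: `α_e T₁ = T₂ − ((1+T₁)^e − 1)` explicitly. [folklore] -/
theorem alpha_X_eq (e : ℕ) : alpha (R := R) e X = C X - ((1 + X) ^ e - 1) := by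
  rw [alpha_X, uOuter_def]

/-- `φ_e` kills `T₂ − ((1+T₁)^e − 1)`. [folklore] -/
theorem spec_ker_gen (e : ℕ) : spec (R := R) e (C X - ((1 + X) ^ e - 1)) = 0 := by
  rw [← uOuter_def, spec_C_X_sub_uOuter]

end Summit.BirchSwinnertonDyer.BirchSwinnertonDyer.Theorems.UniversalToricDescentThinComb.TwoVarSubst

end
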